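import Summits.HodgeConjecture.HodgeConjecture.Theorems.Ring2AbelianAllAndreEvenAnchorPencils
import HarnessLib

/-!
# Ring 2 · AbelianAll — ANDRÉ AXIS, PART Q-c: THE PENCILS THROUGH THE EVEN NON-SPLIT ANCHORS — through a chart `K`-isogenous to an
  even twisted square `T × T̄` polarized in a class `δ ≠ 1` EVERY member is a polarized NON-split Weil `(4j+4)`-fold of class `δ`
  (fact-free); through `E₀^{2j+2} × Ē₀^{2j+2}`, `B⋆` of the ONE total space ⟹ the Weil Hodge conjecture for every member, `⟺` modulo
  Verdier; instance: NON-split Weil EIGHTFOLD pencils (no rung in print)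

HONEST FRAMING (page 1, verbatim): **research route, not a corollary; conditional on HC_CM plus one named minimal statement.** Cell line:
research route conditional on HC_CM; not a corollary; Q11.4-sentence-2 already refuted in dim ≥ 3. Nothing in this file proves a case of the
Hodge conjecture or of `B(X)` for a named `X`: every `B⋆` row is an IMPLICATION with displayed hypotheses. `HC_CM`, `HC_AV` and the global nodes do
NOT occur. NAMED-FACT BINDER (hypothesis of the `⟺` row only): `hGT` = Verdier 1976. Item `Theses.RankFourFaces.CMToAbelian` (stmt-16267) stays
OPEN; N104 untouched; no node is born (0 `def`, 0 `sorry`). Seat `pub-hodge-ring2-ab-andre-2`, gen 47 (part Q). Inputs: part P-c (the even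
anchor pencils, split half), part O-c (non-split is constant along the pencil; Weil type, HC and the class pass along a `K`-isogeny to the
chart; the elliptic-power chart row), part N (the `⟺` row through a chart satisfying HC), parts Q-a/Q-b (AV level: the even twisted squares
`E₀^{2j+2} × Ē₀^{2j+2}` REACH every positive class `[m]` through the two-weight classes `(h_P ⊞ η) ⊠ (h_P ⊞ mη)` — so the hypotheses
«`hδ` of class `δ ≠ 1`» below are satisfiable on EVERY even non-split component, `exists_hodge_nonsplit_weilVariety_of_class_even`).

## Content (theorems only; standard axioms)

* §1 **`nonsplit_weilPencil_of_evenTwistedSquareChart`** (fact-free; the non-split companion of part P-c §4 (i)) — compact abelian pencil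
  with a global endomorphism `Φ` over `S`, `K`-compatible charts, a projective embedding `E` of `𝒳` (relative `K`-symmetrised polarization
  `H_K = d_K·E^*a + Φ^*E^*a`), a global `U₊` on the Weil line at `t` with `U₊|X_t ≠ 0`; the chart at `t` is `K`-isogenous (`gT`) to
  `(T × T, φ_T × (−φ_T))` with `dim T = 2j + 2` and `e_t^*(H_K|X_t) = gT^*h` for a class `h` with a non-degenerate witness of class
  `δ ≠ 1 = [(−1)^{2j+2}]`. THEN every member `(A_s, φ_s)` is a Weil `(4j+4)`-fold of type `(2j+2, d_K)`, polarized by `e_s^*(H_K|X_s)` of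
  class `δ`, and NOT hyperbolic for it: **the pencil lies on the NON-split polarized component `(2j+2, d_K, δ)`**.
* §2 **`lefschetzB_weilPencil_iff_forall_weilClasses_algebraic_of_ellipticPowerTwistedSquareChart_of_verdier`** (parity-free, any `q`) —
  part N's `⟺` row (`B⋆(𝒳, η) ∀η ⟺ W(A_s, φ_s) ⊆ N^{q+1}(A_s) ∀s`, Tankeev data displayed, Verdier for `⟸`) through a chart
  `K`-isogenous to a twisted square `E₀^{q+1} × Ē₀^{q+1}` of an elliptic power: Weil type AND the Hodge conjecture at the chart
  DISCHARGED (part O-c §1; `Deligne1982.hodgeConjectureFor_powSucc_powSucc`). Part O-c had the `⟹` half for elliptic powers and the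
  `⟺` for prime-dimensional `T` only.
* §3 **`nonsplit_weilPencil_of_ellipticEvenTwistedSquareChart`** — `T = E₀^{2j+2}` with ANY `K`-structure `φ_T`, class `δ ≠ 1` at the
  chart: (i) as §1; (ii) `B⋆(𝒳, η) ∀η ⟹ W(A_s, φ_s) ⊆ N^{2j+2}(A_s)` for EVERY member — fact-free, no `HC_CM`, no Hodge–Weil theorem in
  print; instance **`nonsplit_weilEightfoldPencil_of_ellipticTwistedSquareChart`** (`j = 1`): compact pencils of NON-split
  `ℚ(√−d_K)`-Weil EIGHTFOLDS with `K`-action through `E₀⁴ × Ē₀⁴` — `B⋆` of the ONE 9-fold ⟹ the Weil Hodge conjecture along the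
  pencil, on components `(4, d_K, δ ≠ 1)` that NO rung of the ladder reaches even in unrefereed print (`SplitEightfolds`, R2 =
  `SplitWeilAbelianVarieties` are the class `1`).

## Honest status

Reductions only. With parts O-c (odd, every negative class) and P-c (even, class `1`) the pencils through twisted-square anchors now cover
EVERY polarized component `(n, d_K, δ)` with `sign δ = (−1)ⁿ`, `n ≥ 2`: split components closed modulo the split rungs + Verdier (P-b/P-c),
non-split components — odd (W₆: `B × B̄`, `E³ × Ē³`) AND even (W₈: `E₀⁴ × Ē₀⁴`, …) — carrying the fact-free row «`B⋆` of the one total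
space ⟹ Weil-HC along the pencil». The open instance of the axis is unchanged in strength (W₆ non-split is the smallest); the even
non-split pencils are a second open habitat of the same shape, not a new reduction. `B⋆` of these total spaces is not located in print;
nothing minimal claimed; N104 untouched. EDGE LABELS: §1, §3 K (fact-free); §2 K[Verdier] for `⟸`.
References: vanGeemen1994HodgeAV (4.9, 4.14, Lemma 5.2, 5.4, (5.4.1)); Landherr1936HermitianForms; Verdier1976 (Cor. (5.1)); Tankeev2003
(Thm. 10.1, 11.6); Deligne1982HodgeCycles (§4 Remark 4.10); Andre1996Motifs (§6.3 Lemme 6.3.3, Remarque 2); Markman2025SecantWeil (§1.2).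
-/

noncomputable section

set_option linter.dupNamespace false

namespace Summit.HodgeConjecture.HodgeConjecture.Ring2.AbelianAll

open CategoryTheory CategoryTheory.Limits AlgebraicGeometry MonoidalCategory CartesianMonoidalCategory
open Literature.AlgebraicGeometry Literature.AlgebraicGeometry.Motives
open Literature.AlgebraicGeometry.HodgeTheory Literature.AlgebraicGeometry.VanGeemen1994
open Literature.AlgebraicTopology.SingularHomology (singularCohomology)
open Summit.HodgeConjecture.CorCM.Model

/-! ## §1 Through an even twisted-square chart of class `δ ≠ 1`: every member is polarized non-split -/

section EvenNonsplit

open scoped MonObj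

variable {𝒳 S : SchemeOver ℂ} {f : 𝒳 ⟶ S}

/-- `𝒴` — the fibre square `𝒳 ×_S 𝒳` (display notation for the tree's `familyPullback f f`). -/
local notation3 (prettyPrint := false) "𝒴[" f "]" => familyPullback f f
/-- `𝐚` — the first projection `𝒳 ×_S 𝒳 ⟶ 𝒳`. -/
local notation3 (prettyPrint := false) "𝐚[" f "]" => familyPullback.fst f f
/-- `𝐛` — the second projection `𝒳 ×_S 𝒳 ⟶ 𝒳`. -/
local notation3 (prettyPrint := false) "𝐛[" f "]" => familyPullback.snd f f

/-- **THE PENCILS THROUGH AN EVEN TWISTED SQUARE POLARIZED IN A CLASS `δ ≠ 1` ARE NON-SPLIT PENCILS** (fact-free; companion of part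
P-c §4 (i)). Compact pencil `f : 𝒳 ⟶ S` of abelian varieties with a global endomorphism `Φ` over `S`, `K`-compatible charts
`(A_s, e_s, φ_s)` (`φ_s² = −d_K`, `d_K ≥ 1`), a projective embedding `E` of `𝒳` with a rational ambient `a ≠ 0`
(`H_K = d_K·E^*a + Φ^*E^*a`), a global `U₊` with `e_t^*(U₊|X_t) ∈ E₊(A_t, φ_t)`, `U₊|X_t ≠ 0`; the chart at `t` is `K`-isogenous (`gT`) to
the twisted square `(T × T, φ_T × (−φ_T))` of a `(2j+2)`-fold `T` (`φ_T² = −d_K`), and `e_t^*(H_K|X_t) = gT^*h` for a class `h` on `T × T`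
carrying a non-degenerate discriminant witness of class `δ ≠ 1` — by part Q-b such `h` exist for EVERY positive `δ` when `T = P × E` has a
`K`-stable elliptic factor (two weights). THEN at EVERY member: `(A_s, φ_s)` is a Weil `(4j+4)`-fold of type `(2j+2, d_K)`, `e_s^*(H_K|X_s)`
has class `δ`, and `(A_s, φ_s)` is NOT hyperbolic for it (van Geemen (5.4.1): hyperbolic forces the class `[(−1)^{2j+2}] = 1`) — the pencil
lies on the NON-split polarized component `(2j+2, d_K, δ)`. [cite: vanGeemen1994HodgeAV, 4.9, 4.14, Lemma 5.2 (3), 5.4 and (5.4.1)]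
[cite: Landherr1936HermitianForms] [cite: Andre1996Motifs, §6.3 Lemme 6.3.3 and Remarque 2 (p. 33)] -/
theorem nonsplit_weilPencil_of_evenTwistedSquareChart {j dK : ℕ} (hdK : 0 < dK) {dX : ℕ} (hf : IsCompactAbelianPencil f dX)
    (Φ : 𝒳 ⟶ 𝒳) (hΦ : Φ ≫ f = f)
    (A : ComplexPoints S → AbelianVariety ℂ) (e : ∀ s, (A s).X ≅ fiberOver f s) (φ : ∀ s, A s ⟶ A s)
    (hφ : ∀ s, φ s ≫ φ s = -(dK • 𝟙 (A s)))
    (hK : ∀ s, ∃ Φs : fiberOver f s ⟶ fiberOver f s, Φs ≫ fiberι f s = fiberι f s ≫ Φ ∧ (e s).hom ≫ Φs = (φ s).hom.hom.hom ≫ (e s).hom)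
    (E : ProjectiveEmbedding 𝒳) {a : complexBetti (projectiveSpace E.n ℂ) 2} (ha : IsRationalClass a) (ha0 : a ≠ 0)
    (Up : complexBetti 𝒳 (2 * (2 * j + 2))) {t : ComplexPoints S}
    (hUpt : complexBetti.map (e t).hom (2 * (2 * j + 2)) (complexBetti.map (fiberι f t) (2 * (2 * j + 2)) Up) ∈
      weilClassesPlus (A t) (φ t) (2 * j + 2) dK)
    (hUp0 : complexBetti.map (fiberι f t) (2 * (2 * j + 2)) Up ≠ 0)
    {T : AbelianVariety ℂ} {φT : T ⟶ T} (hT : T.dim = 2 * j + 2) (hφT : φT ≫ φT = -(dK • 𝟙 T))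
    (gT : A t ⟶ T.prod T) (hγ : AbelianVariety.IsIsogeny gT)
    (hcomm : gT ≫ AbelianVariety.prodLift (AbelianVariety.fst T T ≫ φT) (AbelianVariety.snd T T ≫ (-φT)) = φ t ≫ gT)
    {h : complexBetti (T.prod T).X 2} {δ : weilNormResidueGroup dK} (hne : δ ≠ 1)
    (hδ : HasWeilDiscriminantNondeg (T.prod T)
      (AbelianVariety.prodLift (AbelianVariety.fst T T ≫ φT) (AbelianVariety.snd T T ≫ (-φT))) (2 * j + 2) dK h δ)
    (hH : complexBetti.map (e t).hom 2 (complexBetti.map (fiberι f t) 2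
      ((dK : ℂ) • complexBetti.map E.ι 2 a + complexBetti.map Φ 2 (complexBetti.map E.ι 2 a))) = complexBetti.map gT.hom.hom.hom 2 h)
    (s : ComplexPoints S) :
    IsWeilType (A s) (φ s) (2 * j + 2) dK ∧
      HasWeilDiscriminantNondeg (A s) (φ s) (2 * j + 2) dK (complexBetti.map (e s).hom 2 (complexBetti.map (fiberι f s) 2
        ((dK : ℂ) • complexBetti.map E.ι 2 a + complexBetti.map Φ 2 (complexBetti.map E.ι 2 a)))) δ ∧
      ¬ IsHyperbolicWeilType (A s) (φ s) (2 * j + 2) (complexBetti.map (e s).hom 2 (complexBetti.map (fiberι f s) 2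
        ((dK : ℂ) • complexBetti.map E.ι 2 a + complexBetti.map Φ 2 (complexBetti.map E.ι 2 a)))) := by
  -- Weil type at the chart (part O-c §1), hence at every member (parts L-d/L-e)
  have hWt : IsWeilType (A t) (φ t) (2 * j + 2) dK := isWeilType_of_isogeny_twistedSquare (by omega) hT hdK hφT (hφ t) gT hγ hcomm
  have hUall : ∀ s, complexBetti.map (e s).hom (2 * (2 * j + 2)) (complexBetti.map (fiberι f s) (2 * (2 * j + 2)) Up) ∈
      weilClassesOf (A s) (φ s) (2 * j + 2) dK :=
    fun s ↦ Submodule.mem_sup_left (map_chart_fiberι_mem_weilClassesPlus_member_of_member hf Φ hΦ A e φ hK Up hUpt s)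
  have hWs : IsWeilType (A s) (φ s) (2 * j + 2) dK := isWeilType_member_of_member hf A e φ hφ Up hUall hWt hUp0 s
  -- the class `δ` at the chart, pulled back along `gT`; then part O-c §2
  have hδt : HasWeilDiscriminantNondeg (A t) (φ t) (2 * j + 2) dK (complexBetti.map (e t).hom 2 (complexBetti.map (fiberι f t) 2
      ((dK : ℂ) • complexBetti.map E.ι 2 a + complexBetti.map Φ 2 (complexBetti.map E.ι 2 a)))) δ := by
    rw [hH]; exact hasWeilDiscriminantNondeg_of_isogeny_twistedSquare gT hγ hcomm hδ
  have hne' : δ ≠ QuotientGroup.mk ((-1 : ℚˣ) ^ (2 * j + 2)) := by rwa [weilNormResidueGroup_mk_neg_one_pow_even]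
  obtain ⟨hδs, hnh⟩ := not_isHyperbolicWeilType_member_of_member hf (n := 2 * j + 2) (by omega) hdK Φ hΦ A e φ hφ hK E ha ha0
    hWt.dim_eq hδt hne' s
  exact ⟨hWs, hδs, hnh⟩

end EvenNonsplit

/-! ## §2 The `⟺` row through a twisted square of an elliptic power (parity-free) -/

section EllipticIff

open scoped MonObj

variable {𝒳 S : SchemeOver ℂ} {f : 𝒳 ⟶ S}

/-- `𝒴` — the fibre square `𝒳 ×_S 𝒳` (display notation for the tree's `familyPullback f f`). -/
local notation3 (prettyPrint := false) "𝒴[" f "]" => familyPullback f f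
/-- `𝐚` — the first projection `𝒳 ×_S 𝒳 ⟶ 𝒳`. -/
local notation3 (prettyPrint := false) "𝐚[" f "]" => familyPullback.fst f f
/-- `𝐛` — the second projection `𝒳 ×_S 𝒳 ⟶ 𝒳`. -/
local notation3 (prettyPrint := false) "𝐛[" f "]" => familyPullback.snd f f

/-- **`B⋆(𝒳, η) ∀η ⟺ W(A_s, φ_s) ⊆ N^{q+1}(A_s)` FOR EVERY MEMBER, through a chart `K`-isogenous to a twisted square `E₀^{q+1} × Ē₀^{q+1}`
of an elliptic power** (ANY `K`-structure `φ_T` on `E₀^{q+1}` with `φ_T² = −d_K`, any parity of `q + 1`) — with the pencil structure of parts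
XL/XLI (θ_N-datum `ν`, group law `mS` charted at `t`, lines off the middle degree, no odd invariants, `Θ, U₊, U₋` spanning the middle invariants at
`t`, `Θ|X_s` algebraic), modulo Verdier for `⟸`; Weil type AND the Hodge conjecture at the chart DISCHARGED (part O-c §1: `det`-free transfer
along the `K`-isogeny; `Deligne1982.hodgeConjectureFor_powSucc_powSucc`). No `HC_CM`, no Hodge–Weil theorem in print. Part O-c had the `⟺`
for prime-dimensional `T` with a full-degree number field; this is Deligne's / André's elliptic anchor in the twisted-square convention.
[cite: Tankeev2008, Thm. (i)–(ii)] [cite: Verdier1976, Cor. (5.1)] [cite: vanGeemen1994HodgeAV, 4.9–4.10, Thm. 4.3 and Lemma 5.2 (6)]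
[cite: Deligne1982HodgeCycles, §4 Remark 4.10] [cite: Andre1996Motifs, §6.3 Lemme 6.3.3 and Remarque 2 (p. 33)] -/
theorem lefschetzB_weilPencil_iff_forall_weilClasses_algebraic_of_ellipticPowerTwistedSquareChart_of_verdier
    (hGT : Verdier1976_genericLocalTriviality) {q dK : ℕ} (hdK : 0 < dK) (hf : IsCompactAbelianPencil f (2 * q + 1 + 1))
    (t : ComplexPoints S) (ν : 𝒳 ⟶ 𝒳) (hν : ν ≫ f = f) {N : ℕ} (hN : 2 ≤ N)
    (hθ : ∀ s : ComplexPoints S, ∃ (νs : fiberOver f s ⟶ fiberOver f s) (A : AbelianVariety ℂ) (e : A.X ≅ fiberOver f s),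
      νs ≫ fiberι f s = fiberι f s ≫ ν ∧ e.hom ≫ νs = (N • 𝟙 A).hom.hom.hom ≫ e.hom)
    (mS : 𝒴[f] ⟶ 𝒳)
    (hmν : (familyPullback.isPullback f f).lift (𝐚[f] ≫ ν) (𝐛[f] ≫ ν) (familyPullback_pair_condition hν) ≫ mS = mS ≫ ν)
    (hchart : ∃ (νt : fiberOver f t ⟶ fiberOver f t) (A : AbelianVariety ℂ) (e : A.X ≅ fiberOver f t),
      νt ≫ fiberι f t = fiberι f t ≫ ν ∧ e.hom ≫ νt = (N • 𝟙 A).hom.hom.hom ≫ e.hom ∧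
      (familyPullback.isPullback f f).lift (fst A.X A.X ≫ e.hom ≫ fiberι f t) (snd A.X A.X ≫ e.hom ≫ fiberι f t)
        (fibreChart_pair_condition t e) ≫ mS = μ[A.X] ≫ e.hom ≫ fiberι f t)
    (hRank : ∀ p : ℕ, 0 < p → p < 2 * q + 1 + 1 → p ≠ q + 1 →
      Module.finrank ℂ (LinearMap.range (complexBetti.map (fiberι f t) (2 * p)).hom) = 1)
    (hOdd : ∀ k' : ℕ, Odd k' → k' ≤ 2 * (2 * q + 1 + 1) → ∀ W : complexBetti 𝒳 k', complexBetti.map (fiberι f t) k' W = 0)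
    (Φ : 𝒳 ⟶ 𝒳) (hΦ : Φ ≫ f = f)
    (A : ComplexPoints S → AbelianVariety ℂ) (e : ∀ s, (A s).X ≅ fiberOver f s) (φ : ∀ s, A s ⟶ A s)
    (hφ : ∀ s, φ s ≫ φ s = -(dK • 𝟙 (A s)))
    (hK : ∀ s, ∃ Φs : fiberOver f s ⟶ fiberOver f s, Φs ≫ fiberι f s = fiberι f s ≫ Φ ∧ (e s).hom ≫ Φs = (φ s).hom.hom.hom ≫ (e s).hom)
    (Θ Up Um : complexBetti 𝒳 (2 * (q + 1)))
    (hspan : ∀ W : complexBetti 𝒳 (2 * (q + 1)), ∃ a b c : ℂ, (complexBetti.map (fiberι f t) (2 * (q + 1))).hom W =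
      a • (complexBetti.map (fiberι f t) (2 * (q + 1))).hom Θ + b • (complexBetti.map (fiberι f t) (2 * (q + 1))).hom Up +
        c • (complexBetti.map (fiberι f t) (2 * (q + 1))).hom Um)
    (hΘ : ∀ s : ComplexPoints S, (complexBetti.map (fiberι f s) (2 * (q + 1))).hom Θ ∈ algebraicClasses (fiberOver f s) (q + 1))
    (hUpt : complexBetti.map (e t).hom (2 * (q + 1)) (complexBetti.map (fiberι f t) (2 * (q + 1)) Up) ∈ weilClassesPlus (A t) (φ t) (q + 1) dK)
    (hUmt : complexBetti.map (e t).hom (2 * (q + 1)) (complexBetti.map (fiberι f t) (2 * (q + 1)) Um) ∈ weilClassesMinus (A t) (φ t) (q + 1) dK)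
    (hUp0 : complexBetti.map (fiberι f t) (2 * (q + 1)) Up ≠ 0)
    {E₀ : AbelianVariety ℂ} (hE : E₀.dim = 1) {φT : E₀.powSucc q ⟶ E₀.powSucc q} (hφT : φT ≫ φT = -(dK • 𝟙 (E₀.powSucc q)))
    (gT : A t ⟶ (E₀.powSucc q).prod (E₀.powSucc q)) (hγ : AbelianVariety.IsIsogeny gT)
    (hcomm : gT ≫ AbelianVariety.prodLift (AbelianVariety.fst _ _ ≫ φT) (AbelianVariety.snd _ _ ≫ (-φT)) = φ t ≫ gT) :
    (∀ ηX : complexBetti 𝒳 2, StandardConjectureBStar (2 * q + 1 + 1 + 1) 𝒳 ηX) ↔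
      ∀ s : ComplexPoints S, weilClassesOf (A s) (φ s) (q + 1) dK ≤ algebraicClasses (A s).X (q + 1) := by
  have h1 : (A t).dim = 2 * q + 1 + 1 := AbelianVariety.dim_eq_of_chart hf (A t) (e t)
  have h2 : (A t).dim = ((E₀.powSucc q).prod (E₀.powSucc q)).dim := AbelianVariety.dim_eq_of_isIsogeny hγ
  have hT : (E₀.powSucc q).dim = q + 1 := by rw [AbelianVariety.dim_prod, h1] at h2; omega
  exact lefschetzB_weilPencil_iff_forall_weilClasses_algebraic_of_hodgeConjectureFor_chart_of_verdier hGT hf t ν hν hN hθ mS hmν hchart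
    hRank hOdd Φ hΦ A e φ hφ hK Θ Up Um hspan hΘ hUpt hUmt hUp0
    (isWeilType_of_isogeny_twistedSquare (by omega) hT hdK hφT (hφ t) gT hγ hcomm)
    (hodgeConjectureFor_of_isogeny_twistedSquare_ellipticPower hE q gT hγ)

end EllipticIff

/-! ## §3 Through `E₀^{2j+2} × Ē₀^{2j+2}`: non-split habitat AND `B⋆ ⟹` Weil-HC along the pencil; eightfolds -/

section EllipticEven

variable {𝒳 S : SchemeOver ℂ} {f : 𝒳 ⟶ S}

/-- **THE NON-SPLIT EVEN PENCILS THROUGH `E₀^{2j+2} × Ē₀^{2j+2}`: HABITAT AND ROW.** Compact pencil `f : 𝒳 ⟶ S` of abelian `(4j+4)`-folds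
with a global endomorphism `Φ` over `S`, `K`-compatible charts `(A_s, e_s, φ_s)` (`φ_s² = −d_K`, `d_K ≥ 1`), a projective embedding `E` of `𝒳`
with a rational ambient `a ≠ 0` (`H_K = d_K·E^*a + Φ^*E^*a`), a global `U₊` on the Weil line `E₊` at `t` with `U₊|X_t ≠ 0`; the chart at `t`
is `K`-isogenous (`gT`) to the twisted square `(T × T, φ_T × (−φ_T))` of `T = E₀^{2j+2}` (`dim E₀ = 1`, ANY `φ_T` with `φ_T² = −d_K`) and
`e_t^*(H_K|X_t) = gT^*h` for a class `h` with a non-degenerate witness of class `δ ≠ 1` (part Q-b: for the diagonal `φ_T` and the two-weight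
class `(h_P ⊞ η) ⊠ (h_P ⊞ mη)` one gets `δ = [m]`, every positive class). THEN (i) EVERY member `(A_s, φ_s)` is a Weil `(4j+4)`-fold of type
`(2j+2, d_K)`, polarized by `e_s^*(H_K|X_s)` of class `δ` and NOT hyperbolic for it — the pencil lies on the NON-split polarized component
`(2j+2, d_K, δ)` —; (ii) `B⋆(𝒳, η) ∀η ⟹ W(A_s, φ_s) ⊆ N^{2j+2}(A_s)` for EVERY member (part O-c's elliptic-power chart row: HC at the chart
by `Deligne1982.hodgeConjectureFor_powSucc_powSucc`). Fact-free; no `HC_CM`; no Hodge–Weil theorem in print.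
[cite: vanGeemen1994HodgeAV, 4.9, 4.14, Lemma 5.2 (3), 5.4, (5.4.1) and Thm. 4.3] [cite: Landherr1936HermitianForms]
[cite: Deligne1982HodgeCycles, §4 Remark 4.10] [cite: Andre1996Motifs, §6.3 Lemme 6.3.3 and Remarque 2 (p. 33)] -/
theorem nonsplit_weilPencil_of_ellipticEvenTwistedSquareChart {j dK : ℕ} (hdK : 0 < dK)
    (hf : IsCompactAbelianPencil f (2 * (2 * j + 1) + 1 + 1))
    (Φ : 𝒳 ⟶ 𝒳) (hΦ : Φ ≫ f = f)
    (A : ComplexPoints S → AbelianVariety ℂ) (e : ∀ s, (A s).X ≅ fiberOver f s) (φ : ∀ s, A s ⟶ A s)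
    (hφ : ∀ s, φ s ≫ φ s = -(dK • 𝟙 (A s)))
    (hK : ∀ s, ∃ Φs : fiberOver f s ⟶ fiberOver f s, Φs ≫ fiberι f s = fiberι f s ≫ Φ ∧ (e s).hom ≫ Φs = (φ s).hom.hom.hom ≫ (e s).hom)
    (E : ProjectiveEmbedding 𝒳) {a : complexBetti (projectiveSpace E.n ℂ) 2} (ha : IsRationalClass a) (ha0 : a ≠ 0)
    (Up : complexBetti 𝒳 (2 * (2 * j + 1 + 1))) {t : ComplexPoints S}
    (hUpt : complexBetti.map (e t).hom (2 * (2 * j + 1 + 1)) (complexBetti.map (fiberι f t) (2 * (2 * j + 1 + 1)) Up) ∈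
      weilClassesPlus (A t) (φ t) (2 * j + 1 + 1) dK)
    (hUp0 : complexBetti.map (fiberι f t) (2 * (2 * j + 1 + 1)) Up ≠ 0)
    {E₀ : AbelianVariety ℂ} (hE : E₀.dim = 1) {φT : E₀.powSucc (2 * j + 1) ⟶ E₀.powSucc (2 * j + 1)}
    (hφT : φT ≫ φT = -(dK • 𝟙 (E₀.powSucc (2 * j + 1))))
    (gT : A t ⟶ (E₀.powSucc (2 * j + 1)).prod (E₀.powSucc (2 * j + 1))) (hγ : AbelianVariety.IsIsogeny gT)
    (hcomm : gT ≫ AbelianVariety.prodLift (AbelianVariety.fst _ _ ≫ φT) (AbelianVariety.snd _ _ ≫ (-φT)) = φ t ≫ gT)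
    {h : complexBetti ((E₀.powSucc (2 * j + 1)).prod (E₀.powSucc (2 * j + 1))).X 2} {δ : weilNormResidueGroup dK} (hne : δ ≠ 1)
    (hδ : HasWeilDiscriminantNondeg ((E₀.powSucc (2 * j + 1)).prod (E₀.powSucc (2 * j + 1)))
      (AbelianVariety.prodLift (AbelianVariety.fst _ _ ≫ φT) (AbelianVariety.snd _ _ ≫ (-φT))) (2 * j + 1 + 1) dK h δ)
    (hH : complexBetti.map (e t).hom 2 (complexBetti.map (fiberι f t) 2
      ((dK : ℂ) • complexBetti.map E.ι 2 a + complexBetti.map Φ 2 (complexBetti.map E.ι 2 a))) = complexBetti.map gT.hom.hom.hom 2 h)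
    (s : ComplexPoints S) :
    IsWeilType (A s) (φ s) (2 * j + 1 + 1) dK ∧
      HasWeilDiscriminantNondeg (A s) (φ s) (2 * j + 1 + 1) dK (complexBetti.map (e s).hom 2 (complexBetti.map (fiberι f s) 2
        ((dK : ℂ) • complexBetti.map E.ι 2 a + complexBetti.map Φ 2 (complexBetti.map E.ι 2 a)))) δ ∧
      ¬ IsHyperbolicWeilType (A s) (φ s) (2 * j + 1 + 1) (complexBetti.map (e s).hom 2 (complexBetti.map (fiberι f s) 2
        ((dK : ℂ) • complexBetti.map E.ι 2 a + complexBetti.map Φ 2 (complexBetti.map E.ι 2 a)))) ∧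
      ((∀ ηX : complexBetti 𝒳 2, StandardConjectureBStar (2 * (2 * j + 1) + 1 + 1 + 1) 𝒳 ηX) →
        weilClassesOf (A s) (φ s) (2 * j + 1 + 1) dK ≤ algebraicClasses (A s).X (2 * j + 1 + 1)) := by
  have hT : (E₀.powSucc (2 * j + 1)).dim = 2 * j + 2 := by rw [dim_powSucc', hE]; ring
  obtain ⟨hWs, hδs, hnh⟩ := nonsplit_weilPencil_of_evenTwistedSquareChart hdK hf Φ hΦ A e φ hφ hK E ha ha0 Up hUpt hUp0 hT hφT gT hγ
    hcomm hne hδ hH s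
  exact ⟨hWs, hδs, hnh, fun hB ↦
    weilClassesOf_le_algebraicClasses_forall_of_lefschetzB_of_ellipticPowerTwistedSquareChart (q := 2 * j + 1) hdK hf hB Φ hΦ A e φ hφ
      hK Up hUpt hUp0 hE hφT gT hγ hcomm s⟩

/-- **W₈, NON-SPLIT, THROUGH `E₀⁴ × Ē₀⁴`** (`j = 1`): on a compact pencil of `ℚ(√−d_K)`-Weil EIGHTFOLDS with its `K`-action through a chart
`K`-isogenous to the twisted square of `E₀⁴` polarized in a class `δ ≠ 1`, EVERY member is a polarized NON-split Weil eightfold of class `δ`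
(type `(4, d_K)`), and `B⋆` of the ONE 9-fold total space ⟹ the Weil Hodge conjecture for EVERY member — fact-free. The components
`(4, d_K, δ ≠ 1)` are reached by NO rung of the ladder in print (`SplitEightfolds` and R2 = [Markman2025] are the class `1`); by part Q-b they
all contain such an anchor (`exists_hodge_nonsplit_weilEightfold_gaussian_three`: `(4, ℚ(i), [3])`). [cite: vanGeemen1994HodgeAV, 4.14 and (5.4.1)]
[cite: Markman2025SecantWeil, §1.2] [cite: Deligne1982HodgeCycles, §4 Remark 4.10] [cite: Andre1996Motifs, §6.3 Lemme 6.3.3 and Remarque 2 (p. 33)] -/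
theorem nonsplit_weilEightfoldPencil_of_ellipticTwistedSquareChart {dK : ℕ} (hdK : 0 < dK)
    (hf : IsCompactAbelianPencil f (2 * (2 * 1 + 1) + 1 + 1))
    (Φ : 𝒳 ⟶ 𝒳) (hΦ : Φ ≫ f = f)
    (A : ComplexPoints S → AbelianVariety ℂ) (e : ∀ s, (A s).X ≅ fiberOver f s) (φ : ∀ s, A s ⟶ A s)
    (hφ : ∀ s, φ s ≫ φ s = -(dK • 𝟙 (A s)))
    (hK : ∀ s, ∃ Φs : fiberOver f s ⟶ fiberOver f s, Φs ≫ fiberι f s = fiberι f s ≫ Φ ∧ (e s).hom ≫ Φs = (φ s).hom.hom.hom ≫ (e s).hom)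
    (E : ProjectiveEmbedding 𝒳) {a : complexBetti (projectiveSpace E.n ℂ) 2} (ha : IsRationalClass a) (ha0 : a ≠ 0)
    (Up : complexBetti 𝒳 (2 * (2 * 1 + 1 + 1))) {t : ComplexPoints S}
    (hUpt : complexBetti.map (e t).hom (2 * (2 * 1 + 1 + 1)) (complexBetti.map (fiberι f t) (2 * (2 * 1 + 1 + 1)) Up) ∈
      weilClassesPlus (A t) (φ t) (2 * 1 + 1 + 1) dK)
    (hUp0 : complexBetti.map (fiberι f t) (2 * (2 * 1 + 1 + 1)) Up ≠ 0)
    {E₀ : AbelianVariety ℂ} (hE : E₀.dim = 1) {φT : E₀.powSucc (2 * 1 + 1) ⟶ E₀.powSucc (2 * 1 + 1)}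
    (hφT : φT ≫ φT = -(dK • 𝟙 (E₀.powSucc (2 * 1 + 1))))
    (gT : A t ⟶ (E₀.powSucc (2 * 1 + 1)).prod (E₀.powSucc (2 * 1 + 1))) (hγ : AbelianVariety.IsIsogeny gT)
    (hcomm : gT ≫ AbelianVariety.prodLift (AbelianVariety.fst _ _ ≫ φT) (AbelianVariety.snd _ _ ≫ (-φT)) = φ t ≫ gT)
    {h : complexBetti ((E₀.powSucc (2 * 1 + 1)).prod (E₀.powSucc (2 * 1 + 1))).X 2} {δ : weilNormResidueGroup dK} (hne : δ ≠ 1)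
    (hδ : HasWeilDiscriminantNondeg ((E₀.powSucc (2 * 1 + 1)).prod (E₀.powSucc (2 * 1 + 1)))
      (AbelianVariety.prodLift (AbelianVariety.fst _ _ ≫ φT) (AbelianVariety.snd _ _ ≫ (-φT))) (2 * 1 + 1 + 1) dK h δ)
    (hH : complexBetti.map (e t).hom 2 (complexBetti.map (fiberι f t) 2
      ((dK : ℂ) • complexBetti.map E.ι 2 a + complexBetti.map Φ 2 (complexBetti.map E.ι 2 a))) = complexBetti.map gT.hom.hom.hom 2 h)
    (s : ComplexPoints S) :
    IsWeilType (A s) (φ s) (2 * 1 + 1 + 1) dK ∧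
      HasWeilDiscriminantNondeg (A s) (φ s) (2 * 1 + 1 + 1) dK (complexBetti.map (e s).hom 2 (complexBetti.map (fiberι f s) 2
        ((dK : ℂ) • complexBetti.map E.ι 2 a + complexBetti.map Φ 2 (complexBetti.map E.ι 2 a)))) δ ∧
      ¬ IsHyperbolicWeilType (A s) (φ s) (2 * 1 + 1 + 1) (complexBetti.map (e s).hom 2 (complexBetti.map (fiberι f s) 2
        ((dK : ℂ) • complexBetti.map E.ι 2 a + complexBetti.map Φ 2 (complexBetti.map E.ι 2 a)))) ∧
      ((∀ ηX : complexBetti 𝒳 2, StandardConjectureBStar (2 * (2 * 1 + 1) + 1 + 1 + 1) 𝒳 ηX) →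
        weilClassesOf (A s) (φ s) (2 * 1 + 1 + 1) dK ≤ algebraicClasses (A s).X (2 * 1 + 1 + 1)) :=
  nonsplit_weilPencil_of_ellipticEvenTwistedSquareChart (j := 1) hdK hf Φ hΦ A e φ hφ hK E ha ha0 Up hUpt hUp0 hE hφT gT hγ hcomm
    hne hδ hH s

end EllipticEven

end Summit.HodgeConjecture.HodgeConjecture.Ring2.AbelianAll

end
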